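import Summits.BirchSwinnertonDyer.Rank1Residual.GaloisImage.NonsplitCartanDictionaryConverse
import HarnessLib

/-!
# BSD rank-≤1 residual cell: at a good SUPERSINGULAR `p ≠ 2` a non-surjective `ρ̄_{E,p}` has image
# EQUAL to the normaliser of a non-split Cartan subgroup (`G = N(kˣ)`, i.e. `= C_ns⁺(p)`:
# Furio–Lombardo's second alternative, unconditionally on these curves)

HONEST FRAMING (cell `b2b-bsdres-*`, run/shared/lean/b2b/bsd-rank1-residual/, verbatim): the goal
of the cell is to DELETE the COMBINATION-SHAPED residual classes for ALL analytic-rank `≤ 1` elliptic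
curves over `ℚ` — "full BSD formula for every rank `≤ 1` curve in class C" assembled STRICTLY from
published theorems — so that the rank-`≤ 1` remainder becomes exactly the CONSTRUCTION-SHAPED
classes, which are TYPED (missing-input Props), NOT attempted; this is not "finishing BSD".
No claim beyond stated classes; census output = EVIDENCE, never a Literature fact.  Unit
`b2b-bsdres-n1011-p04-g2` (team n1011, O8 image strand, row T-O8c, optional T14).  THEOREMS ONLY
(no definition, no named fact, no binder of any published fact).

## What this file does

p251082 proved `kˣ ≤ G ≤ N(kˣ)`, `G ⊄ kˣ` at a good supersingular `p ≠ 2` with `ρ̄_{E,p}` not onto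
(`G = Φ(ρ̄(Γ_ℚ))`, `kˣ` the inertia non-split Cartan subgroup).  Since `(N(kˣ) : kˣ) = 2` (Serre
§2.2; tree `relIndex_normalizer_eq_two`) this pins the image down COMPLETELY:

* `map_range_eq_normalizer_unitGroup_of_goodSS_of_not_surj` — **`G = N(kˣ)`**: the image IS the
  full normaliser of a non-split Cartan subgroup (order `2(p² - 1)`; Sutherland's label `pNn`
  itself, no proper subgroup).
* `exists_gl_forall_mem_normalizer_unitGroup_iff` — the group-theoretic dictionary in `iff` form: for
  a field `k ⊆ M₂(𝔽_p)` of degree `2` (`p ≠ 2`) there are `B ∈ GL₂(𝔽_p)` and a non-square `ε` with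
  `g ∈ N(kˣ) ⟺ B⁻¹ g B ∈ C_ns⁺(ε)` for EVERY `g ∈ GL₂(𝔽_p)` (explicit matrices of
  `SerreUniformity.nonsplitCartanNormalizer`; both directions, from the two dictionary files).
* `hasModPImageEqNonsplitCartanNormalizer_of_map_range_eq` — frame form `G = N(kˣ)` ⟹ the
  dossier's EQUALITY predicate `SerreUniformity.HasModPImageEqNonsplitCartanNormalizer W p` (every
  element of `C_ns⁺(ε)` is the matrix of some `σ`).
* `hasModPImageEqNonsplitCartanNormalizer_of_goodSS_of_not_surj` — **MAIN: at a good supersingular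
  `p ≠ 2` with `ρ̄_{E,p}` not onto, the mod-`p` image is EXACTLY the normaliser of a non-split Cartan
  subgroup** — the second alternative of Furio–Lombardo 2025 Thm. 1.5, here a kernel THEOREM for
  these curves at every odd `p` (FL prove the dichotomy for all non-CM curves at `p > 37`);
  `surj_or_hasModPImageEqNonsplitCartanNormalizer_of_goodSS` — the dichotomy form.

What is NOT claimed: anything for the twist rows (O8 ∩ (G) ∧ ss: `G ≤ N(kˣ)` is p251588; equality
would need the twisted inertia to generate `kˣ` — true, not proved here); any bound on `p`; CM or
non-CM is irrelevant here (CM curves with `p` inert in the CM field are examples).  Census shadow: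
X7 / O8-twist non-surjective supersingular rows carry the FULL label `pNn` (`5Nn` ×73, `7Nn` ×11,
`3Nn`), as the theorem predicts for the untwisted ones.

## References

* [Serre1972] J.-P. Serre, Invent. Math. 15 (1972), §1.11 Prop. 12, §2.2 (`(N : C) = 2`), §2.7
  Prop. 17.
* [FurioLombardo2023] L. Furio, D. Lombardo, arXiv:2305.17780v2, (1.1), Thm. 1.5.
-/

noncomputable section

open scoped Classical
open Matrix Field WeierstrassCurve Literature.NumberTheory.EllipticCurves
  Literature.NumberTheory.GaloisRepresentations Literature.NumberTheory.GaloisRepresentations.Serre1972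
  Literature.NumberTheory.EllipticCurves.Rank1Residual Literature.NumberTheory.SerreUniformity

namespace Summit.BirchSwinnertonDyer.Rank1Residual.GaloisImage

/-! ### §1 The group-theoretic dictionary `N(kˣ) ≅ C_ns⁺(ε)` (both inclusions) -/

section Group

variable {p : ℕ} [hp : Fact p.Prime]

/-- **`N(kˣ)` is conjugate to the explicit `C_ns⁺(ε)`.**  For a subalgebra `k ⊆ M₂(𝔽_p)` which is a
field of degree `2` (`p ≠ 2`) there are `B ∈ GL₂(𝔽_p)` and a non-square `ε ∈ 𝔽_p` such that for
every `g ∈ GL₂(𝔽_p)`: `g ∈ N(kˣ)` iff `B⁻¹ g B` is one of the matrices `(a, εb; b, a)`,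
`(a, -εb; b, -a)` of `nonsplitCartanNormalizer ε`.  (`y₀ = (a₀ b₀; c₀ -a₀) ∈ k` trace-zero,
`ε = a₀² + b₀c₀`, `B = (1 a₀; 0 c₀)`; "⟹" as in `hasNonsplitCartanModPImage_of_le_normalizer_unitGroup`,
"⟸" via `mul_companion_eq_of_mem_nonsplitCartanNormalizer` and Serre §2.2
`mem_unitGroup_of_conj_eq` / `mem_normalizer_unitGroup_of_conj_eq`.)
[cite: Serre1972, §2.1–2.2] [cite: FurioLombardo2023, (1.1)] -/
theorem exists_gl_forall_mem_normalizer_unitGroup_iff (hp2 : p ≠ 2)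
    {k : Subalgebra (ZMod p) (Matrix (Fin 2) (Fin 2) (ZMod p))} (hk : IsField k)
    (h2 : Module.finrank (ZMod p) k = 2) :
    ∃ (B : GL (Fin 2) (ZMod p)) (ε : ZMod p), ¬ IsSquare ε ∧
      ∀ g : GL (Fin 2) (ZMod p),
        g ∈ Subgroup.normalizer (unitGroup k : Set (GL (Fin 2) (ZMod p))) ↔
          ((B⁻¹ * g * B : GL (Fin 2) (ZMod p)) : Matrix (Fin 2) (Fin 2) (ZMod p)) ∈
            nonsplitCartanNormalizer ε := by
  have htwo : (2 : ZMod p) ≠ 0 := DeligneSerre1974.two_ne_zero_of_ne_two hp2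
  obtain ⟨a, b, c, hy, hys⟩ := exists_traceZero_mem htwo h2
  obtain ⟨hc, hε⟩ := ne_zero_and_not_isSquare hk hy hys
  have hYtr : Matrix.trace !![a, b; c, -a] = 0 := by rw [Matrix.trace_fin_two_of]; ring
  have hBdet : Matrix.det !![(1 : ZMod p), a; 0, c] ≠ 0 := by
    rw [Matrix.det_fin_two_of]; simpa using hc
  set B : GL (Fin 2) (ZMod p) := Matrix.GeneralLinearGroup.mkOfDetNeZero _ hBdet with hB
  set Bm : Matrix (Fin 2) (Fin 2) (ZMod p) := ((B : GL (Fin 2) (ZMod p)) : Matrix (Fin 2) (Fin 2) (ZMod p))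
    with hBm
  set Bi : Matrix (Fin 2) (Fin 2) (ZMod p) :=
    ((B⁻¹ : GL (Fin 2) (ZMod p)) : Matrix (Fin 2) (Fin 2) (ZMod p)) with hBi
  have hBval : Bm = !![(1 : ZMod p), a; 0, c] := rfl
  have hBBi : Bm * Bi = 1 := by rw [hBm, hBi, ← Units.val_mul, mul_inv_cancel, Units.val_one]
  have hBiB : Bi * Bm = 1 := by rw [hBm, hBi, ← Units.val_mul, inv_mul_cancel, Units.val_one]
  have hBM : Bm * !![(0 : ZMod p), a ^ 2 + b * c; 1, 0] = !![a, b; c, -a] * Bm := by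
    rw [hBval]; exact mul_normalForm a b c
  -- `M := B⁻¹ y₀ B` is the companion matrix, and `y₀ = B M B⁻¹`
  have hconj : Bi * !![a, b; c, -a] * Bm = !![(0 : ZMod p), a ^ 2 + b * c; 1, 0] := by
    rw [Matrix.mul_assoc, ← hBM, ← Matrix.mul_assoc, hBiB, Matrix.one_mul]
  have hconj' : Bm * !![(0 : ZMod p), a ^ 2 + b * c; 1, 0] * Bi = !![a, b; c, -a] := by
    rw [hBM, Matrix.mul_assoc, hBBi, Matrix.mul_one]
  refine ⟨B, a ^ 2 + b * c, hε, fun g ↦ ?_⟩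
  -- the conjugate `m = B⁻¹ g B` and the products `m M`, `M m`
  have hmval : ((B⁻¹ * g * B : GL (Fin 2) (ZMod p)) : Matrix (Fin 2) (Fin 2) (ZMod p)) =
      Bi * (g : Matrix (Fin 2) (Fin 2) (ZMod p)) * Bm := by
    rw [Units.val_mul, Units.val_mul]
  set m : Matrix (Fin 2) (Fin 2) (ZMod p) := Bi * (g : Matrix (Fin 2) (Fin 2) (ZMod p)) * Bm with hm
  have hmM : m * !![(0 : ZMod p), a ^ 2 + b * c; 1, 0] =
      Bi * ((g : Matrix (Fin 2) (Fin 2) (ZMod p)) * !![a, b; c, -a]) * Bm := by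
    rw [hm, ← hconj]
    calc Bi * (g : Matrix (Fin 2) (Fin 2) (ZMod p)) * Bm * (Bi * !![a, b; c, -a] * Bm)
        = Bi * (g : Matrix (Fin 2) (Fin 2) (ZMod p)) * (Bm * Bi) * !![a, b; c, -a] * Bm := by
          simp only [Matrix.mul_assoc]
      _ = Bi * ((g : Matrix (Fin 2) (Fin 2) (ZMod p)) * !![a, b; c, -a]) * Bm := by
          rw [hBBi, Matrix.mul_one]; simp only [Matrix.mul_assoc]
  have hMm : !![(0 : ZMod p), a ^ 2 + b * c; 1, 0] * m =
      Bi * (!![a, b; c, -a] * (g : Matrix (Fin 2) (Fin 2) (ZMod p))) * Bm := by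
    rw [hm, ← hconj]
    calc Bi * !![a, b; c, -a] * Bm * (Bi * (g : Matrix (Fin 2) (Fin 2) (ZMod p)) * Bm)
        = Bi * !![a, b; c, -a] * (Bm * Bi) * (g : Matrix (Fin 2) (Fin 2) (ZMod p)) * Bm := by
          simp only [Matrix.mul_assoc]
      _ = Bi * (!![a, b; c, -a] * (g : Matrix (Fin 2) (Fin 2) (ZMod p))) * Bm := by
          rw [hBBi, Matrix.mul_one]; simp only [Matrix.mul_assoc]
  -- and conversely `g y₀`, `y₀ g` through `m M`, `M m`
  have hgY : (g : Matrix (Fin 2) (Fin 2) (ZMod p)) * !![a, b; c, -a] =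
      Bm * (m * !![(0 : ZMod p), a ^ 2 + b * c; 1, 0]) * Bi := by
    rw [hmM]
    calc (g : Matrix (Fin 2) (Fin 2) (ZMod p)) * !![a, b; c, -a]
        = (Bm * Bi) * ((g : Matrix (Fin 2) (Fin 2) (ZMod p)) * !![a, b; c, -a]) * (Bm * Bi) := by
          rw [hBBi, Matrix.one_mul, Matrix.mul_one]
      _ = Bm * (Bi * ((g : Matrix (Fin 2) (Fin 2) (ZMod p)) * !![a, b; c, -a]) * Bm) * Bi := by
          simp only [Matrix.mul_assoc]
  have hYg : !![a, b; c, -a] * (g : Matrix (Fin 2) (Fin 2) (ZMod p)) =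
      Bm * (!![(0 : ZMod p), a ^ 2 + b * c; 1, 0] * m) * Bi := by
    rw [hMm]
    calc !![a, b; c, -a] * (g : Matrix (Fin 2) (Fin 2) (ZMod p))
        = (Bm * Bi) * (!![a, b; c, -a] * (g : Matrix (Fin 2) (Fin 2) (ZMod p))) * (Bm * Bi) := by
          rw [hBBi, Matrix.one_mul, Matrix.mul_one]
      _ = Bm * (Bi * (!![a, b; c, -a] * (g : Matrix (Fin 2) (Fin 2) (ZMod p))) * Bm) * Bi := by
          simp only [Matrix.mul_assoc]
  have hginv : (g : Matrix (Fin 2) (Fin 2) (ZMod p))⁻¹ * (g : Matrix (Fin 2) (Fin 2) (ZMod p)) = 1 :=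
    Matrix.nonsing_inv_mul _ (GL2.det_ne_zero g).isUnit
  have hginv' : (g : Matrix (Fin 2) (Fin 2) (ZMod p)) * (g : Matrix (Fin 2) (Fin 2) (ZMod p))⁻¹ = 1 :=
    Matrix.mul_nonsing_inv _ (GL2.det_ne_zero g).isUnit
  have hmdet : m.det ≠ 0 := by rw [← hmval]; exact GL2.det_ne_zero _
  rw [hmval]
  constructor
  · -- `g ∈ N(kˣ)` ⟹ `m ∈ C_ns⁺(ε)`
    intro hgN
    have hne : ∀ {u v : ZMod p}, m 0 0 = u → m 1 0 = v →
        (m = !![u, (a ^ 2 + b * c) * v; v, u] ∨ m = !![u, -((a ^ 2 + b * c) * v); v, -u]) →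
        (u, v) ≠ (0, 0) := by
      rintro u v rfl rfl hshape h
      simp only [Prod.mk.injEq] at h
      apply hmdet
      rcases hshape with hs | hs <;> rw [hs, Matrix.det_fin_two_of, h.1, h.2] <;> ring
    rcases conj_eq_or_conj_eq_of_mem_normalizer hk hy hys hgN with h | h
    · have hgY' : (g : Matrix (Fin 2) (Fin 2) (ZMod p)) * !![a, b; c, -a] =
          !![a, b; c, -a] * (g : Matrix (Fin 2) (Fin 2) (ZMod p)) := by
        calc (g : Matrix (Fin 2) (Fin 2) (ZMod p)) * !![a, b; c, -a]
            = (g : Matrix (Fin 2) (Fin 2) (ZMod p)) * !![a, b; c, -a] *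
                ((g : Matrix (Fin 2) (Fin 2) (ZMod p))⁻¹ * (g : Matrix (Fin 2) (Fin 2) (ZMod p))) := by
              rw [hginv, Matrix.mul_one]
          _ = (g : Matrix (Fin 2) (Fin 2) (ZMod p)) * !![a, b; c, -a] *
                (g : Matrix (Fin 2) (Fin 2) (ZMod p))⁻¹ * (g : Matrix (Fin 2) (Fin 2) (ZMod p)) := by
              simp only [Matrix.mul_assoc]
          _ = !![a, b; c, -a] * (g : Matrix (Fin 2) (Fin 2) (ZMod p)) := by rw [h]
      have hcomm : m * !![(0 : ZMod p), a ^ 2 + b * c; 1, 0] =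
          !![(0 : ZMod p), a ^ 2 + b * c; 1, 0] * m := by rw [hmM, hMm, hgY']
      have hshape := eq_of_commute_normalForm hcomm
      exact ⟨m 0 0, m 1 0, hne rfl rfl (Or.inl hshape), Or.inl hshape⟩
    · rw [hYtr, zero_smul, zero_sub] at h
      have hgY' : (g : Matrix (Fin 2) (Fin 2) (ZMod p)) * !![a, b; c, -a] =
          -(!![a, b; c, -a] * (g : Matrix (Fin 2) (Fin 2) (ZMod p))) := by
        calc (g : Matrix (Fin 2) (Fin 2) (ZMod p)) * !![a, b; c, -a]
            = (g : Matrix (Fin 2) (Fin 2) (ZMod p)) * !![a, b; c, -a] *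
                ((g : Matrix (Fin 2) (Fin 2) (ZMod p))⁻¹ * (g : Matrix (Fin 2) (Fin 2) (ZMod p))) := by
              rw [hginv, Matrix.mul_one]
          _ = (g : Matrix (Fin 2) (Fin 2) (ZMod p)) * !![a, b; c, -a] *
                (g : Matrix (Fin 2) (Fin 2) (ZMod p))⁻¹ * (g : Matrix (Fin 2) (Fin 2) (ZMod p)) := by
              simp only [Matrix.mul_assoc]
          _ = -(!![a, b; c, -a] * (g : Matrix (Fin 2) (Fin 2) (ZMod p))) := by
              rw [h, Matrix.neg_mul]
      have hanti : m * !![(0 : ZMod p), a ^ 2 + b * c; 1, 0] =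
          -(!![(0 : ZMod p), a ^ 2 + b * c; 1, 0] * m) := by
        rw [hmM, hMm, hgY', Matrix.mul_neg, Matrix.neg_mul]
      have hshape := eq_of_anticommute_normalForm hanti
      exact ⟨m 0 0, m 1 0, hne rfl rfl (Or.inr hshape), Or.inr hshape⟩
  · -- `m ∈ C_ns⁺(ε)` ⟹ `g ∈ N(kˣ)`
    intro hmN
    rcases mul_companion_eq_of_mem_nonsplitCartanNormalizer hmN with hmM' | hmM'
    · -- `m` commutes with `M`: `g` commutes with `y₀`, hence `g ∈ kˣ`
      have hgY' : (g : Matrix (Fin 2) (Fin 2) (ZMod p)) * !![a, b; c, -a] =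
          !![a, b; c, -a] * (g : Matrix (Fin 2) (Fin 2) (ZMod p)) := by rw [hgY, hYg, hmM']
      have hconjg : (g : Matrix (Fin 2) (Fin 2) (ZMod p)) * !![a, b; c, -a] *
          (g : Matrix (Fin 2) (Fin 2) (ZMod p))⁻¹ = !![a, b; c, -a] := by
        rw [hgY', Matrix.mul_assoc, hginv', Matrix.mul_one]
      exact Subgroup.le_normalizer (mem_unitGroup_of_conj_eq hy hys hconjg)
    · -- `m` anti-commutes with `M`: `g y₀ g⁻¹ = -y₀ = ȳ₀`, hence `g ∈ N(kˣ)`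
      have hgY' : (g : Matrix (Fin 2) (Fin 2) (ZMod p)) * !![a, b; c, -a] =
          -(!![a, b; c, -a] * (g : Matrix (Fin 2) (Fin 2) (ZMod p))) := by
        rw [hgY, hYg, hmM', Matrix.mul_neg, Matrix.neg_mul]
      have hconjg : (g : Matrix (Fin 2) (Fin 2) (ZMod p)) * !![a, b; c, -a] *
          (g : Matrix (Fin 2) (Fin 2) (ZMod p))⁻¹ =
            Matrix.trace !![a, b; c, -a] • (1 : Matrix (Fin 2) (Fin 2) (ZMod p)) - !![a, b; c, -a] := by
        rw [hYtr, zero_smul, zero_sub, hgY', Matrix.neg_mul, Matrix.mul_assoc, hginv', Matrix.mul_one]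
      exact mem_normalizer_unitGroup_of_conj_eq h2 hy hys hconjg

end Group

/-! ### §2 At a good supersingular prime the image IS the normaliser -/

section Curve

variable (W : WeierstrassCurve ℚ) [W.IsElliptic] (p : ℕ) [hp : Fact p.Prime]
  (Φ : Multiplicative (AddAut (geomTorsion W p)) ≃* GL (Fin 2) (ZMod p))
  (e : geomTorsion W p ≃+ (Fin 2 → ZMod p))
  (he : ∀ (g : Multiplicative (AddAut (geomTorsion W p))) (x : geomTorsion W p),
    e (Multiplicative.toAdd g x) =
      ((Φ g : GL (Fin 2) (ZMod p)) : Matrix (Fin 2) (Fin 2) (ZMod p)) *ᵥ e x)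

include he in
/-- **`G = N(kˣ)` at a good supersingular `p ≠ 2` with `ρ̄_{E,p}` not onto** (`W` globally
minimal): the image `Φ(ρ̄_{E,p}(Γ_ℚ))` EQUALS the normaliser of the inertia non-split Cartan
subgroup `kˣ`.  From p251082 (`kˣ ≤ G ≤ N(kˣ)`, `G ⊄ kˣ`) and `(N(kˣ) : kˣ) = 2`
(`relIndex_normalizer_eq_two`): `(kˣ : G)·(G : N) = 2` with `(kˣ : G) ≠ 1`.  So the image is the
FULL group `C_ns⁺(p)` of order `2(p² - 1)` — no proper subgroup of the normaliser occurs at a good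
supersingular prime. [cite: Serre1972, §1.11 Prop. 12, §2.2, §2.7 Prop. 17] -/
theorem map_range_eq_normalizer_unitGroup_of_goodSS_of_not_surj [W.IsGloballyMinimal] (hp2 : p ≠ 2)
    (hss : GoodSS W p) (hns : ¬ Surj W p) :
    ∃ k : Subalgebra (ZMod p) (Matrix (Fin 2) (Fin 2) (ZMod p)), IsField k ∧
      Module.finrank (ZMod p) k = 2 ∧
      (galoisRepTorsion W p).range.map Φ.toMonoidHom =
        Subgroup.normalizer (unitGroup k : Set (GL (Fin 2) (ZMod p))) := by
  obtain ⟨k, hk, h2, hCG, hGN, hGC⟩ :=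
    exists_le_normalizer_unitGroup_of_goodSS_of_not_surj W p Φ e he hp2 hss hns
  refine ⟨k, hk, h2, le_antisymm hGN ?_⟩
  set G : Subgroup (GL (Fin 2) (ZMod p)) := (galoisRepTorsion W p).range.map Φ.toMonoidHom with hG
  set N : Subgroup (GL (Fin 2) (ZMod p)) :=
    Subgroup.normalizer (unitGroup k : Set (GL (Fin 2) (ZMod p))) with hN
  have hC : unitGroup k ∈ cartanSubgroups (ZMod p) := unitGroup_mem_cartanSubgroups hk h2
  have h2i : (unitGroup k).relIndex N = 2 := relIndex_normalizer_eq_two hC (fun _ ↦ hp2)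
  have hmul := Subgroup.relIndex_mul_relIndex (unitGroup k) G N hCG hGN
  rw [h2i] at hmul
  have hCG1 : (unitGroup k).relIndex G ≠ 1 := fun h ↦ hGC (Subgroup.relIndex_eq_one.mp h)
  have hGN1 : G.relIndex N = 1 := by
    have hdvd : (unitGroup k).relIndex G ∣ 2 := Dvd.intro _ hmul
    rcases (Nat.dvd_prime Nat.prime_two).mp hdvd with h1 | h2'
    · exact absurd h1 hCG1
    · rw [h2'] at hmul
      omega
  exact Subgroup.relIndex_eq_one.mp hGN1

omit [W.IsElliptic] in
include he in
/-- **Frame form `G = N(kˣ)` ⟹ the dossier's EQUALITY predicate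
`HasModPImageEqNonsplitCartanNormalizer W p`** (`p ≠ 2`): in the basis `x ↦ B⁻¹ e(x)` of
`exists_gl_forall_mem_normalizer_unitGroup_iff`, every `σ` acts through an element of `C_ns⁺(ε)`, and
every `M ∈ C_ns⁺(ε)` is the matrix of some `σ` (`B M B⁻¹ ∈ N(kˣ) = G`).
[cite: Serre1972, §2.1–2.2] [cite: FurioLombardo2023, (1.1)] -/
theorem hasModPImageEqNonsplitCartanNormalizer_of_map_range_eq (hp2 : p ≠ 2)
    {k : Subalgebra (ZMod p) (Matrix (Fin 2) (Fin 2) (ZMod p))} (hk : IsField k)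
    (h2 : Module.finrank (ZMod p) k = 2)
    (hG : (galoisRepTorsion W p).range.map Φ.toMonoidHom =
      Subgroup.normalizer (unitGroup k : Set (GL (Fin 2) (ZMod p)))) :
    HasModPImageEqNonsplitCartanNormalizer W p := by
  obtain ⟨B, ε, hε, hiff⟩ := exists_gl_forall_mem_normalizer_unitGroup_iff hp2 hk h2
  set Bm : Matrix (Fin 2) (Fin 2) (ZMod p) := ((B : GL (Fin 2) (ZMod p)) : Matrix (Fin 2) (Fin 2) (ZMod p))
    with hBm
  set Bi : Matrix (Fin 2) (Fin 2) (ZMod p) :=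
    ((B⁻¹ : GL (Fin 2) (ZMod p)) : Matrix (Fin 2) (Fin 2) (ZMod p)) with hBi
  have hBBi : Bm * Bi = 1 := by rw [hBm, hBi, ← Units.val_mul, mul_inv_cancel, Units.val_one]
  have hBiB : Bi * Bm = 1 := by rw [hBm, hBi, ← Units.val_mul, inv_mul_cancel, Units.val_one]
  let Q : (Fin 2 → ZMod p) ≃+ (Fin 2 → ZMod p) :=
    { toFun := fun v ↦ Bi *ᵥ v
      invFun := fun v ↦ Bm *ᵥ v
      left_inv := fun v ↦ by
        simp only [Matrix.mulVec_mulVec, hBBi, Matrix.one_mulVec]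
      right_inv := fun v ↦ by
        simp only [Matrix.mulVec_mulVec, hBiB, Matrix.one_mulVec]
      map_add' := fun v w ↦ Matrix.mulVec_add _ _ _ }
  have hQ : ∀ v, Q v = Bi *ᵥ v := fun _ ↦ rfl
  have hact : ∀ (σ : absoluteGaloisGroup ℚ) (P : geomTorsion W p),
      (e.trans Q) (σ • P) =
        ((B⁻¹ * Φ (galoisRepTorsion W p σ) * B : GL (Fin 2) (ZMod p)) :
          Matrix (Fin 2) (Fin 2) (ZMod p)) *ᵥ (e.trans Q) P := fun σ P ↦ by
    rw [AddEquiv.trans_apply, AddEquiv.trans_apply, hQ, hQ, ← galoisRepTorsion_apply W p σ P,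
      he (galoisRepTorsion W p σ) P, Units.val_mul, Units.val_mul, Matrix.mulVec_mulVec,
      Matrix.mulVec_mulVec, Matrix.mul_assoc (Bi * _), hBBi, Matrix.mul_one]
  refine ⟨e.trans Q, ε, hε, fun σ ↦ ?_, fun M hM ↦ ?_⟩
  · have hgN : Φ (galoisRepTorsion W p σ) ∈
        Subgroup.normalizer (unitGroup k : Set (GL (Fin 2) (ZMod p))) := by
      rw [← hG]; exact apply_galoisRepTorsion_mem_map_range W p Φ σ
    exact ⟨_, (hiff _).mp hgN, hact σ⟩
  · -- `M ∈ C_ns⁺(ε)` is invertible; `g = B M B⁻¹ ∈ N(kˣ) = G` is some `Φ(ρ̄ σ)`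
    have hMdet : M.det ≠ 0 := det_ne_zero_of_mem_nonsplitCartanNormalizer hε hM
    set gM : GL (Fin 2) (ZMod p) := Matrix.GeneralLinearGroup.mkOfDetNeZero M hMdet with hgM
    have hgMval : ((gM : GL (Fin 2) (ZMod p)) : Matrix (Fin 2) (Fin 2) (ZMod p)) = M := rfl
    set g : GL (Fin 2) (ZMod p) := B * gM * B⁻¹ with hg
    have hconj : B⁻¹ * g * B = gM := by rw [hg]; group
    have hgN : g ∈ Subgroup.normalizer (unitGroup k : Set (GL (Fin 2) (ZMod p))) := by
      rw [hiff g, hconj, hgMval]; exact hM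
    rw [← hG] at hgN
    obtain ⟨σ, hσ⟩ := (mem_map_range_galoisRepTorsion_iff W p Φ).mp hgN
    refine ⟨σ, fun P ↦ ?_⟩
    rw [hact σ P, hσ, hconj, hgMval]

/-- **MAIN — at a good supersingular `p ≠ 2` with `ρ̄_{E,p}` not onto, the mod-`p` image is EXACTLY
the normaliser of a non-split Cartan subgroup** (`HasModPImageEqNonsplitCartanNormalizer W p`, the
second alternative of Furio–Lombardo 2025 Thm. 1.5 — there a theorem for non-CM curves and
`p > 37`; here a kernel theorem for good-supersingular primes, every odd `p`, CM or not).
[cite: Serre1972, §1.11 Prop. 12, §2.2, §2.7 Prop. 17] [cite: FurioLombardo2023, Thm. 1.5] -/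
theorem hasModPImageEqNonsplitCartanNormalizer_of_goodSS_of_not_surj [W.IsGloballyMinimal]
    (hp2 : p ≠ 2) (hss : GoodSS W p) (hns : ¬ Surj W p) :
    HasModPImageEqNonsplitCartanNormalizer W p := by
  obtain ⟨e, Φ, he, -⟩ := exists_frame_galoisRepTorsion_rat W p
  obtain ⟨k, hk, h2, hG⟩ := map_range_eq_normalizer_unitGroup_of_goodSS_of_not_surj W p Φ e he hp2 hss hns
  exact hasModPImageEqNonsplitCartanNormalizer_of_map_range_eq W p Φ e he hp2 hk h2 hG

/-- **Dichotomy at a good supersingular `p ≠ 2`, dossier form: `ρ̄_{E,p}` is onto, or its image is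
EXACTLY the normaliser of a non-split Cartan subgroup** — Furio–Lombardo's dichotomy, here
unconditional and for every odd good-supersingular `p`. [cite: Serre1972, §2.7 Prop. 17]
[cite: FurioLombardo2023, Thm. 1.5] -/
theorem surj_or_hasModPImageEqNonsplitCartanNormalizer_of_goodSS [W.IsGloballyMinimal]
    (hp2 : p ≠ 2) (hss : GoodSS W p) :
    Surj W p ∨ HasModPImageEqNonsplitCartanNormalizer W p := by
  by_cases hns : Surj W p
  · exact Or.inl hns
  · exact Or.inr (hasModPImageEqNonsplitCartanNormalizer_of_goodSS_of_not_surj W p hp2 hss hns)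

end Curve

end Summit.BirchSwinnertonDyer.Rank1Residual.GaloisImage

end
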